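import Summits.QuantumFields.YangMills.Theorems.UnitScaleTiltProp7CoerciveOfGaugeFixedLift
import Summits.QuantumFields.YangMills.Theorems.UnitScaleTiltProp7PureGaugeCurlCurvature
import Summits.QuantumFields.YangMills.Theorems.UnitScaleTiltProp7DivRecoveryCoarseRows
import HarnessLib

/-!
# Route `UnitScaleTilt`, crux «MinimiserStabilityRegPr» (stmt-QuantumFields-19200, stub EX), node N06(d = 3), route (α) — **THE QUANTITATIVE THM 3.11 ROW AT PRINT'S OWN
# SLOT `Δ_a = Δ^η(+T_J) + D R_S D* + Q*aQ` ((3.26)) UNDER THE LIFT ANTECEDENT NEEDS THE GAUGE-FIXED SLICE ROW ONLY**: the covariant curl of a residual pure-gauge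
# one-form is the curvature commutator, hence `O(ε₀)`-small RELATIVE TO THE FORM under `Lift` ([Balaban1985BackgroundPropagators] (3.9)–(3.10): `𝒟D_{U₀}λ = [U₀(∂p), ·]`,
# and `[U₀(∂p), λ₀] = 0` on the parallel part), so the (3.118) split `x = Pᴾx + Dλ` perturbs the raw form `re⟨x, Δ^η x⟩` off the slice by `O(ε₀)` only

Cell `ym3-torus` (HUMAN RULING D-0037, YM ladder rung R3 — YM₃ on T³ is a RUNG, NOT d = 4, NOT the Clay problem; the YM mass gap is NOT proved).  Fleet lead seat
`ym-ust-19200-p1` (gen 22), positivity-block lane of the EX face; sequel of ✓`Prop7CoerciveOfGaugeFixedLift` (same seat: the `Pᴾ`-sandwiched slots `Δ₁ᴾ(T_J)`).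
THEOREMS ONLY (0 `def`, 0 `sorry`); `--supports stmt-QuantumFields-19200 --as helper`; count-neutral.  NOTHING of [B9] §3's analysis at a curved background is asserted: the
file composes ✓`Prop7DeltaEtaAlmostPositive` ∕ ✓`Prop7DeltaPrimeL2Bound` (★w4 g8: (3.10) `Δ^η = η⁻²(𝒟*𝒟 + Δ′)`, `|Δ′| ≤ 1029ε₀η²`), ✓`Prop7CovariantCurlOfGrad` (w2-20520:
`‖𝒟Dλ(p)‖ ≤ 2‖U₀(∂p) − 1‖‖λ‖`), ✓`Prop7PosOfGaugeFixed` ((3.118) split) and ✓`Prop7CoerciveOfGaugeFixedLift` (the gradient floor ∕ mod-`ker D` Poincaré row on `N_S` under `Lift`).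

THE PRINT.  [Balaban1985BackgroundPropagators] p. 392 (3.9)–(3.12): *«⟨A,ΔA⟩ = ⟨A, D*DA⟩ + ⟨A, Δ′A⟩ … Δ′ will be a bounded, small operator, which will be treated as a small
perturbation of D*D»*, `D` = the covariant derivative from bond to plaquette functions (covariant CURL); (3.26) p. 395 `Δ_a(U) = Δ^η(U) + DR(U)D* + Q*(U)aQ(U)`; Thm 3.11 p. 416
*«the operators Δ′_a, G′, (Q′G′²Q′*)⁻¹, Δ_a, G are positive definite»*; (3.118)–(3.120) p. 419.  [Balaban1985Variational] (14) p. 280 (`|U₀(∂p) − 1| < ε₀η²` on (6)(e)).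

PART 1∕2 = ✓`Prop7PureGaugeCurlCurvature` (same seat): §1–§4 below are THERE (`normSq_curl_pureGauge_le`, `sum_normSq_curl_pureGauge_le_of_regPr`, `principal_two_sided_of_regPr`,
`principal_split`); this file is §5–§6.
WHAT IS PROVED (ns `…Theorems.Prop7CoerciveRawSlotOfGaugeFixedLift`; member `F n K`, `h : n ≤ K`, weights `c₀ cB > 0`).
* §1 `toL2_symm_DL2_toL2S_apply`, `formComp_DL2_toL2S` (the pure-gauge one-form `D_{U₀}λ` in `covD (torusT)` letters), ★ `normSq_curl_pureGauge_le` — ANY background, per plaquette: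
  `‖(𝒟(D_{U₀}toL2S λ))(p_{μν}(x))‖_F² ≤ 8η⁻²‖U₀(∂p) − 1‖²‖λ(x+e_μ+e_ν)‖_F²`.
* §2 ★★ `sum_normSq_curl_pureGauge_le_of_regPr` — `U₀ ∈ 𝔘_k(ε₀)`: `Σ_{p>0} ‖(𝒟 D_{U₀}λ)(p)‖_F² ≤ 72ε₀²η²·Σ_x‖λ(x)‖_F²`.
* §3 ★★ `principal_two_sided_of_regPr` — `U₀ ∈ 𝔘_k(ε₀)`: `c₀η⁻²P(X) − 1029ε₀‖X̃‖² ≤ re⟨X̃, Δ^η(U₀)X̃⟩ ≤ c₀η⁻²P(X) + 1029ε₀‖X̃‖²`, `P(X) := Σ_{p>0}‖(𝒟X)(p)‖_F²` (★w4's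
  almost-positivity with the principal part KEPT, both sides).
* §4 `curl_formComp_add`, ★ `principal_split` — `P(A) ≤ 2P(A + G) + 2P(G)` (the principal part is a sum of squares of a LINEAR map).
* §5 ★★ `principal_pureGauge_le_of_lift` — `U₀ ∈ 𝔘_k(ε₀)`, `10¹²L³ε₀ ≤ 1`, `Lift`, `toL2S λ ∈ N_S(U₀)`: `c₀η⁻²P(D_{U₀}λ) ≤ 144ε₀²‖D_{U₀}toL2S λ‖²`
  (apply §2 to ★px20's representative `λ₁`: same `Dλ`, `‖λ₁‖² ≤ 2‖Dλ‖²`); ★★★ `coercive_laplaceA_rawSlot_of_gaugeFixed_of_lift` — THE ROW: `U₀ ∈ 𝔘_k(ε₀)`, `10¹²L³ε₀ ≤ 1`,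
  `Lift`, `0 ≤ a`, a J-term slot `T` with `‖⟨u, T(U₀)v⟩‖ ≤ τ‖u‖‖v‖`, the gauge-fixed slice floor `γ‖A‖² ≤ re⟨A, (Δ^η + T)A⟩ + a‖Q_kA‖²` on `{R_S D* A = 0}`, windows
  `3τ + 1029ε₀ ≤ γ`, `288ε₀² + 4τ ≤ 1` ⟹ `∀ x, (min (γ − 3τ − 1029ε₀) (1 − 288ε₀² − 4τ) ∕ 4 − 1029ε₀)·‖x‖² ≤ re⟨x, laplaceA … a (DeltaEtaSlot + T) U₀ x⟩` — the c1–c4 ∕ R-CORE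
  shape of ★★OWNER RULING g28-№13 at the EX display's `hPosΔ` slot (`DeltaEtaSlot + TJSlotP`), behind `Lift`; ★ `gaugeFixedFloor_add_of_bound` — a slice floor `γ` at slot
  `Δ^η` and a J-term bound `τ` give the slice floor `γ − τ` at slot `Δ^η + T` (so ALL slots of this lane read ONE slice row + `τ`).
* §6 ★★ `coerciveRow_rawSlot_of_gaugeFixedRow_lift` — the family-level row in the EX face's letters (`Lift` opaque + `hLiftRec`, window `10¹²L³αcap L ≤ 1`, rows for the slice floor
  `γ L i` and the J-term bound `τ L i` on `RegPr`, numeric windows per member) ⟹ `∀ L>1 ∀ i ∀ U₀ ρ, RegPr ρ U₀ → ρ ≤ αcap L → Lift L i U₀ → ∀ x, c(L,i)‖x‖² ≤ re⟨x, Δ_a x⟩`;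
  ★★ `hPosΔ_lift_of_gaugeFixedRow` — THE EX DISPLAY ROW `hPosΔ` IN ITS LIFT-THREAD 2 TEXT (`Lift L i U₀ →` after `ρ ≤ αcap L →`, slot `DeltaEtaSlot + TJSlotP`) from the same rows
  under the strict window `4·1029·αcap L < min (…) (…)`.
EFFECT (numbers, not adjectives): together with ✓`Prop7CoerciveOfGaugeFixedLift`, ALL THREE quantitative positivity slots of the EX face (`Δ₁ᴾ(T_J)`, `Δ_πᴾ`, `Δ^η + T_J`) follow,
behind the `Lift` antecedent of record and on `RegPr(αcap)`, from ONE analytic input: the gauge-fixed slice floor `γ` of `Δ^η (+T_J) + aQ_k†Q_k` on `{R_S D* A = 0}` (plus the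
J-term bound `τ` where `T_J ≠ 0`), with explicit member-uniform constants; no `N_S`-row, no `norm_G₀`-row is needed for them.  What a supplier owes is `γ` (LOCATE-RCORE-w4g8
(γ)∕(δ): [B9] Thm 3.3-class) and nothing else.
HONEST SCOPE.  Lattice bookkeeping and Hilbert-space algebra over landed rows; no estimate of print at a curved background beyond the cited (3.10) bound is proved; `hPosΔ`,
`hPosπ`, `hPos₁`, the other print rows, `hThm2S`, EX, the crux are NOT proved; nothing continuum ∕ OS ∕ mass-gap ∕ Clay.

References: T. Bałaban, CMP **99** (1985) 389–434 [Balaban1985BackgroundPropagators] ((3.1)–(3.4) pp.390–391, (3.9)–(3.12) p.392, (3.21)–(3.26) pp.394–395, (3.69) p.404,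
(3.118)–(3.122) pp.419–420, Thm 3.11 p.416); CMP **102** (1985) 277–309 [Balaban1985Variational] ((2) p.278, (14) p.280, (141)–(142) p.299); CMP **98** (1985) 17–51
[Balaban1985Averaging] ((18)–(20) p.21, (97) p.32).
-/

set_option autoImplicit false

noncomputable section

open scoped InnerProductSpace ComplexConjugate Matrix.Norms.L2Operator BigOperators

namespace Summit.QuantumFields.YangMills.Theorems.Prop7CoerciveRawSlotOfGaugeFixedLift

open Literature.MathematicalPhysics.QuantumFieldTheory.Balaban1983to89
open Literature.MathematicalPhysics.QuantumFieldTheory.Balaban1983to89.T3ContinuumYM3Torus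
open Literature.MathematicalPhysics.QuantumFieldTheory.Balaban1983to89.T3PrintedRegularMinimiser (RegPr)
open Literature.MathematicalPhysics.QuantumFieldTheory.Balaban1983to89.T3RegularMinimiser (regThreshold)
open T4Continuum BlockAveraging
open T3SectALandauChart (formComp bgUnits covCodiffCurlT covDerivFwdT eta eta_pos)
open B9TorusCalculus (torusT torusT_comm)
open B9Eq39Adjoint (R covD curl plaqU posPlaq curl_smul covD_add)
open B9Eq310Hermitian (deltaPrimeOp)
open B11Eq103H1Complex (SiteL2K BondL2K)
open Summit.QuantumFields.YangMills.Theorems.Prop7SectET3Transport (periodsT3)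
open Summit.QuantumFields.YangMills.Theorems.Prop7SectET3HilbertLetters (W₂ frobEquiv frobEquiv_symm_apply_apply toL2 toL2S DL2 DstarL2 covLapSite)
open Summit.QuantumFields.YangMills.Theorems.Prop7SecondOrderDict (val_plaqU_torusT_eq_plaqFT norm_bgUnits_le_one norm_plaqFT_bgUnits_sub_one_le covDerivFwdT_eq_smul_covD)
open Summit.QuantumFields.YangMills.Theorems.Prop7LandauDict (DL2_toL2S_eq_covDerivFwdT)
open Summit.QuantumFields.YangMills.Theorems.Prop7CovariantCurlOfGrad (norm_curl_covD_le)
open Summit.QuantumFields.YangMills.Theorems.Prop7RieszTauFrobNorm (norm_sq_frobEquiv_symm norm_le_norm_frobEquiv_symm sum_norm_sq_le_two_mul_opNorm_sq)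
open Summit.QuantumFields.YangMills.Theorems.Prop7PureGaugeCurlCurvature (normSq_curl_pureGauge_le sum_normSq_curl_pureGauge_le_of_regPr principal_two_sided_of_regPr principal_split)

variable {F : T3Family} {n K : ℕ} {c₀ : ℝ}

/-! ## §5 Under `Lift`: the principal part of a residual pure-gauge one-form is `O(ε₀²)`-small, and the raw-slot coercivity row follows from the slice row -/

open Summit.QuantumFields.YangMills.Theorems.Prop7SectET3GaugeProjector (NS RS)
open Summit.QuantumFields.YangMills.Theorems.Prop7SectET3CurvedPropagators (Qk laplaceA)
open Summit.QuantumFields.YangMills.Theorems.Prop7SectET3DeltaPiPInv (gaugeCorrP)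
open Summit.QuantumFields.YangMills.Theorems.Prop7PosOfGaugeFixed (exists_gauge_decomposition Qk_gaugeCorrP RS_DstarL2_gaugeCorrP)
open Summit.QuantumFields.YangMills.Theorems.Prop7LaplaceAFlatCoercive (re_inner_laplaceA)
open Summit.QuantumFields.YangMills.Theorems.Prop7CoerciveOfGaugeFixedLift (normFloor_modKer_NS_of_lift gradFloor_NS_of_lift)
open Summit.QuantumFields.YangMills.Theorems.Prop7DivRecoveryCoarseRows (norm_sq_toL2S_eq)
open Summit.QuantumFields.YangMills.Theorems.Prop7SectET3WilsonHessian (DeltaEta DeltaEtaSlot DeltaEtaSlot_apply)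
open B7TransferAnalyticMean (meanCLM)
open B7Prop1Explicit (disp)
open B10Eq27TorusAxialLog (holT transl)
open B15DeterminingSets (embIter)
open Summit.QuantumFields.YangMills.Theorems.Prop8Chart (emlIterU)

section Lift

variable (F)
variable [Fact (0 < c₀)] {h : n ≤ K} {cB a : ℝ} [Fact (0 < cB)]

omit [Fact (0 < cB)] in
/-- ★★ **UNDER THE LIFT ANTECEDENT THE PRINCIPAL PART OF A RESIDUAL PURE-GAUGE ONE-FORM IS CURVATURE-SMALL RELATIVE TO THE FORM ITSELF**: `U₀ ∈ 𝔘_k(ε₀)`, `10¹²L³ε₀ ≤ 1`,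
`Lift`, `toL2S λ ∈ N_S(U₀)`, `g := D_{U₀}(toL2S λ)` ⟹ `c₀η⁻²·Σ_p ‖(𝒟 g)(p)‖_F² ≤ 144·ε₀²·‖g‖²` — the curl of `g` only sees `λ` through `Dλ` (`[U₀(∂p), λ₀] = 0` for the
parallel part), and the representative `λ₁` of ★px20's (H-Z) row has `‖λ₁‖² ≤ 2‖g‖²`. [cite: Balaban1985BackgroundPropagators, (3.9)–(3.10) p.392, (3.21) p.394; Balaban1985Averaging, (97) p.32] -/
theorem principal_pureGauge_le_of_lift {ε₀ : ℝ} (hε₀ : 0 < ε₀) (hWε : 10 ^ 12 * (F.L : ℝ) ^ 3 * ε₀ ≤ 1)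
    (U₀ : GaugeField (F.P K) 0 (Matrix.specialUnitaryGroup (Fin 2) ℂ)) (hreg : RegPr F n K ε₀ U₀)
    (hLift : ∀ cf : Site (F.P K) (K - n) → Matrix (Fin 2) (Fin 2) ℂ,
      (∀ e : PBond (F.P K) (K - n), cf e.src = ((emlIterU (K - n) (bgUnits F K U₀) e : (Matrix (Fin 2) (Fin 2) ℂ)ˣ) : Matrix (Fin 2) (Fin 2) ℂ) * cf e.tgt *
        (((emlIterU (K - n) (bgUnits F K U₀) e)⁻¹ : (Matrix (Fin 2) (Fin 2) ℂ)ˣ) : Matrix (Fin 2) (Fin 2) ℂ)) →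
      ∃ l₀ : Site (F.P K) 0 → Matrix (Fin 2) (Fin 2) ℂ,
        (∀ b : PBond (F.P K) 0, l₀ b.src = ((bgUnits F K U₀ b : (Matrix (Fin 2) (Fin 2) ℂ)ˣ) : Matrix (Fin 2) (Fin 2) ℂ) * l₀ b.tgt * (((bgUnits F K U₀ b)⁻¹ : (Matrix (Fin 2) (Fin 2) ℂ)ˣ) : Matrix (Fin 2) (Fin 2) ℂ)) ∧
        ∀ y : Site (F.P K) (K - n), l₀ (embIter (K - n) y) = cf y)
    (lam : Site (F.P K) 0 → Matrix (Fin 2) (Fin 2) ℂ) (hl : toL2S F K c₀ lam ∈ NS F n K h c₀ cB U₀) :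
    c₀ * (eta F n K)⁻¹ ^ 2 * ∑ q ∈ posPlaq (Site (F.P K) 0) (Fin (F.P K).d),
        ‖(frobEquiv.symm (curl (torusT (F.P K) 0) (fun μ z => bgUnits F K U₀ ⟨z, μ⟩)
          (formComp ((toL2 F K c₀).symm (DL2 F n K c₀ U₀ (toL2S F K c₀ lam)))) q.2.1 q.2.2 q.1) : W₂)‖ ^ 2
      ≤ 144 * ε₀ ^ 2 * ‖DL2 F n K c₀ U₀ (toL2S F K c₀ lam)‖ ^ 2 := by
  have hc₀ : 0 < c₀ := Fact.out
  have hη : 0 < eta F n K := eta_pos F n K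
  obtain ⟨l₁, -, -, hD, hP⟩ := normFloor_modKer_NS_of_lift F h hε₀ hWε U₀ hreg hLift lam hl
  -- the pure-gauge form of `λ` IS that of `λ₁`; apply §2 to `λ₁`
  rw [← hD]
  have h1 := sum_normSq_curl_pureGauge_le_of_regPr (c₀ := c₀) U₀ hreg l₁
  have h2 : c₀ * ∑ x : Site (F.P K) 0, ‖(frobEquiv.symm (l₁ x) : W₂)‖ ^ 2 ≤ 2 * ‖DL2 F n K c₀ U₀ (toL2S F K c₀ l₁)‖ ^ 2 := by
    rw [← norm_sq_toL2S_eq]; rw [hD]; exact hP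
  have hk : 0 ≤ c₀ * (eta F n K)⁻¹ ^ 2 := by positivity
  calc c₀ * (eta F n K)⁻¹ ^ 2 * _ ≤ c₀ * (eta F n K)⁻¹ ^ 2 * (72 * ε₀ ^ 2 * eta F n K ^ 2 * ∑ x : Site (F.P K) 0, ‖(frobEquiv.symm (l₁ x) : W₂)‖ ^ 2) :=
        mul_le_mul_of_nonneg_left h1 hk
    _ = 72 * ε₀ ^ 2 * ((eta F n K)⁻¹ ^ 2 * eta F n K ^ 2) * (c₀ * ∑ x : Site (F.P K) 0, ‖(frobEquiv.symm (l₁ x) : W₂)‖ ^ 2) := by ring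
    _ = 72 * ε₀ ^ 2 * (c₀ * ∑ x : Site (F.P K) 0, ‖(frobEquiv.symm (l₁ x) : W₂)‖ ^ 2) := by rw [inv_pow, inv_mul_cancel₀ (pow_ne_zero 2 hη.ne'), mul_one]
    _ ≤ 72 * ε₀ ^ 2 * (2 * ‖DL2 F n K c₀ U₀ (toL2S F K c₀ l₁)‖ ^ 2) := mul_le_mul_of_nonneg_left h2 (by positivity)
    _ = 144 * ε₀ ^ 2 * ‖DL2 F n K c₀ U₀ (toL2S F K c₀ l₁)‖ ^ 2 := by ring

/-- ★★★ **UNDER THE LIFT ANTECEDENT, THE QUANTITATIVE THM 3.11 ROW AT THE RAW SLOT `Δ^η + T` (print's `Δ_a = Δ^η + DRD* + Q*aQ` of (3.26), `T` a bounded J-term) NEEDS THE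
GAUGE-FIXED SLICE FLOOR ONLY.**  `U₀ ∈ 𝔘_k(ε₀)` (`RegPr`, `10¹²L³ε₀ ≤ 1`), `Lift`, `0 ≤ a`, `‖⟪u, T(U₀)v⟫‖ ≤ τ‖u‖‖v‖`, and the slice floor
`γ‖A‖² ≤ re⟨A, (Δ^η + T)A⟩ + a‖Q_kA‖²` on `{R_S D* A = 0}` in the window `3τ + 1029ε₀ ≤ γ`, `288ε₀² + 4τ ≤ 1` ⟹ for ALL `x`
`(min (γ − 3τ − 1029ε₀) (1 − 288ε₀² − 4τ) ∕ 4 − 1029ε₀)·‖x‖² ≤ re⟨x, Δ_a(U₀)x⟩`, `Δ_a = laplaceA … a (DeltaEtaSlot + T)`.  Proof: `x = Pᴾx + Dλ` ((3.118)); the form of `Δ^η` is its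
principal part `‖𝒟·‖²` up to `±1029ε₀‖·‖²` (§3); the principal part splits (§4) and is `≤ 144ε₀²‖Dλ‖²` on the pure-gauge piece (§5); the penalty `‖R_S D* x‖² = ‖Δ^ηλ‖² ≥ ½‖Dλ‖²`
(✓`gradFloor_NS_of_lift`); `T` is handled by Cauchy–Schwarz. [cite: Balaban1985BackgroundPropagators, Thm 3.11 p.416, (3.26) p.395, (3.10) p.392, (3.118)–(3.122) pp.419–420; Balaban1985Variational, (141)–(142) p.299] -/
theorem coercive_laplaceA_rawSlot_of_gaugeFixed_of_lift (h : n ≤ K) {ε₀ : ℝ} (hε₀ : 0 < ε₀) (hWε : 10 ^ 12 * (F.L : ℝ) ^ 3 * ε₀ ≤ 1) (ha : 0 ≤ a)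
    (T : GaugeField (F.P K) 0 (Matrix.specialUnitaryGroup (Fin 2) ℂ) → (BondL2K ℂ 3 (periodsT3 F K) c₀ W₂ →ₗ[ℂ] BondL2K ℂ 3 (periodsT3 F K) c₀ W₂))
    (U₀ : GaugeField (F.P K) 0 (Matrix.specialUnitaryGroup (Fin 2) ℂ)) (hreg : RegPr F n K ε₀ U₀)
    (hLift : ∀ cf : Site (F.P K) (K - n) → Matrix (Fin 2) (Fin 2) ℂ,
      (∀ e : PBond (F.P K) (K - n), cf e.src = ((emlIterU (K - n) (bgUnits F K U₀) e : (Matrix (Fin 2) (Fin 2) ℂ)ˣ) : Matrix (Fin 2) (Fin 2) ℂ) * cf e.tgt *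
        (((emlIterU (K - n) (bgUnits F K U₀) e)⁻¹ : (Matrix (Fin 2) (Fin 2) ℂ)ˣ) : Matrix (Fin 2) (Fin 2) ℂ)) →
      ∃ l₀ : Site (F.P K) 0 → Matrix (Fin 2) (Fin 2) ℂ,
        (∀ b : PBond (F.P K) 0, l₀ b.src = ((bgUnits F K U₀ b : (Matrix (Fin 2) (Fin 2) ℂ)ˣ) : Matrix (Fin 2) (Fin 2) ℂ) * l₀ b.tgt * (((bgUnits F K U₀ b)⁻¹ : (Matrix (Fin 2) (Fin 2) ℂ)ˣ) : Matrix (Fin 2) (Fin 2) ℂ)) ∧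
        ∀ y : Site (F.P K) (K - n), l₀ (embIter (K - n) y) = cf y)
    {τ : ℝ} (hτ : 0 ≤ τ) (hT : ∀ u v : BondL2K ℂ 3 (periodsT3 F K) c₀ W₂, ‖⟪u, T U₀ v⟫_ℂ‖ ≤ τ * ‖u‖ * ‖v‖)
    {γ : ℝ} (hwin₁ : 3 * τ + 1029 * ε₀ ≤ γ) (hwin₂ : 288 * ε₀ ^ 2 + 4 * τ ≤ 1)
    (hgf : ∀ A : BondL2K ℂ 3 (periodsT3 F K) c₀ W₂, RS F n K h c₀ cB U₀ (DstarL2 F n K c₀ U₀ A) = 0 →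
      γ * ‖A‖ ^ 2 ≤ RCLike.re ⟪A, DeltaEta F n K c₀ U₀ A + T U₀ A⟫_ℂ + a * ‖Qk F n K h c₀ cB U₀ A‖ ^ 2) :
    ∀ x : BondL2K ℂ 3 (periodsT3 F K) c₀ W₂,
      (min (γ - 3 * τ - 1029 * ε₀) (1 - 288 * ε₀ ^ 2 - 4 * τ) / 4 - 1029 * ε₀) * ‖x‖ ^ 2
        ≤ RCLike.re ⟪x, laplaceA F n K h c₀ cB a (DeltaEtaSlot F n K c₀ + T) U₀ x⟫_ℂ := by
  intro x
  have hc₀ : 0 < c₀ := Fact.out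
  have hη : 0 < eta F n K := eta_pos F n K
  have hk0 : 0 ≤ c₀ * (eta F n K)⁻¹ ^ 2 := by positivity
  -- the three terms of `Δ_a` at the raw slot
  rw [re_inner_laplaceA a (DeltaEtaSlot F n K c₀ + T) U₀ x]
  have hslot : RCLike.re ⟪x, (DeltaEtaSlot F n K c₀ + T) U₀ x⟫_ℂ = RCLike.re ⟪x, DeltaEta F n K c₀ U₀ x⟫_ℂ + RCLike.re ⟪x, T U₀ x⟫_ℂ := by
    rw [Pi.add_apply, LinearMap.add_apply, DeltaEtaSlot_apply, inner_add_right, map_add]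
  rw [hslot]
  -- (3.118): `x = A + g`, `A := Pᴾx` gauge-fixed, `g := Dλ`, `λ ∈ N_S`, `R_S D* x = Δ^η λ`
  obtain ⟨l, hl, hxd, hR⟩ := exists_gauge_decomposition (h := h) (cB := cB) ha U₀ x
  -- slice floor at `A` (same averages as `x`)
  have hgfA := hgf (gaugeCorrP F n K h c₀ cB a U₀ x) (RS_DstarL2_gaugeCorrP ha U₀ x)
  rw [Qk_gaugeCorrP ha U₀ x, inner_add_right, map_add] at hgfA
  -- gauge penalty: `‖R_S D* x‖² = ‖Δ^η λ‖² ≥ ½‖g‖²`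
  have hpen : (1 / 2 : ℝ) * ‖DL2 F n K c₀ U₀ l‖ ^ 2 ≤ ‖RS F n K h c₀ cB U₀ (DstarL2 F n K c₀ U₀ x)‖ ^ 2 := by
    rw [hR]; exact gradFloor_NS_of_lift F h hε₀ hWε U₀ hreg hLift l hl
  -- carriers: `x = toL2 ((toL2)⁻¹ x)` etc., `(toL2)⁻¹ x = (toL2)⁻¹ A + (toL2)⁻¹ g`
  have ex : toL2 F K c₀ ((toL2 F K c₀).symm x) = x := LinearEquiv.apply_symm_apply _ _
  have eA : toL2 F K c₀ ((toL2 F K c₀).symm (gaugeCorrP F n K h c₀ cB a U₀ x)) = gaugeCorrP F n K h c₀ cB a U₀ x := LinearEquiv.apply_symm_apply _ _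
  have hsum : (toL2 F K c₀).symm x = (toL2 F K c₀).symm (gaugeCorrP F n K h c₀ cB a U₀ x) + (toL2 F K c₀).symm (DL2 F n K c₀ U₀ l) := by
    rw [← map_add, ← hxd]
  -- §3 at `x` (lower bound) and at `A` (upper bound)
  have h3x := (principal_two_sided_of_regPr (c₀ := c₀) hε₀.le U₀ hreg ((toL2 F K c₀).symm x)).1
  have h3A := (principal_two_sided_of_regPr (c₀ := c₀) hε₀.le U₀ hreg ((toL2 F K c₀).symm (gaugeCorrP F n K h c₀ cB a U₀ x))).2
  rw [ex] at h3x
  rw [eA] at h3A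
  -- §4: `P(A) ≤ 2 P(x) + 2 P(g)`, multiplied by `c₀η⁻²`
  have h4 := principal_split U₀ ((toL2 F K c₀).symm (gaugeCorrP F n K h c₀ cB a U₀ x)) ((toL2 F K c₀).symm (DL2 F n K c₀ U₀ l))
  rw [← hsum] at h4
  have hk4 := mul_le_mul_of_nonneg_left h4 hk0
  -- §5: the pure-gauge principal part is `≤ 144 ε₀² ‖g‖²`
  have h5 : c₀ * (eta F n K)⁻¹ ^ 2 * ∑ q ∈ posPlaq (Site (F.P K) 0) (Fin (F.P K).d),
      ‖(frobEquiv.symm (curl (torusT (F.P K) 0) (fun μ z => bgUnits F K U₀ ⟨z, μ⟩)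
        (formComp ((toL2 F K c₀).symm (DL2 F n K c₀ U₀ l))) q.2.1 q.2.2 q.1) : W₂)‖ ^ 2
      ≤ 144 * ε₀ ^ 2 * ‖DL2 F n K c₀ U₀ l‖ ^ 2 := by
    have hlam : toL2S F K c₀ ((toL2S F K c₀).symm l) = l := LinearEquiv.apply_symm_apply _ _
    have hlN : toL2S F K c₀ ((toL2S F K c₀).symm l) ∈ NS F n K h c₀ cB U₀ := by rw [hlam]; exact hl
    have := principal_pureGauge_le_of_lift F (h := h) (cB := cB) hε₀ hWε U₀ hreg hLift _ hlN
    rw [hlam] at this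
    exact this
  -- `T` terms by Cauchy–Schwarz
  have reT : ∀ u v : BondL2K ℂ 3 (periodsT3 F K) c₀ W₂, -(τ * ‖u‖ * ‖v‖) ≤ RCLike.re ⟪u, T U₀ v⟫_ℂ := fun u v => by
    have h1 := RCLike.re_le_norm (K := ℂ) (-⟪u, T U₀ v⟫_ℂ)
    rw [map_neg, norm_neg] at h1
    linarith [hT u v]
  have eT : RCLike.re ⟪x, T U₀ x⟫_ℂ = RCLike.re ⟪gaugeCorrP F n K h c₀ cB a U₀ x, T U₀ (gaugeCorrP F n K h c₀ cB a U₀ x)⟫_ℂ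
      + RCLike.re ⟪gaugeCorrP F n K h c₀ cB a U₀ x, T U₀ (DL2 F n K c₀ U₀ l)⟫_ℂ + RCLike.re ⟪DL2 F n K c₀ U₀ l, T U₀ (gaugeCorrP F n K h c₀ cB a U₀ x)⟫_ℂ
      + RCLike.re ⟪DL2 F n K c₀ U₀ l, T U₀ (DL2 F n K c₀ U₀ l)⟫_ℂ := by
    conv_lhs => rw [hxd]
    rw [map_add, inner_add_left, inner_add_right, inner_add_right, map_add, map_add, map_add]
    ring
  have hT1 := reT (gaugeCorrP F n K h c₀ cB a U₀ x) (DL2 F n K c₀ U₀ l)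
  have hT2 := reT (DL2 F n K c₀ U₀ l) (gaugeCorrP F n K h c₀ cB a U₀ x)
  have hT3 := reT (DL2 F n K c₀ U₀ l) (DL2 F n K c₀ U₀ l)
  have hT4 := reT (gaugeCorrP F n K h c₀ cB a U₀ x) (gaugeCorrP F n K h c₀ cB a U₀ x)
  have hτsq := mul_nonneg hτ (sq_nonneg (‖gaugeCorrP F n K h c₀ cB a U₀ x‖ - ‖DL2 F n K c₀ U₀ l‖))
  -- norms: `‖x‖² ≤ (‖A‖ + ‖g‖)²`
  have hnx : ‖x‖ ^ 2 ≤ (‖gaugeCorrP F n K h c₀ cB a U₀ x‖ + ‖DL2 F n K c₀ U₀ l‖) ^ 2 := by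
    have htri := norm_add_le (gaugeCorrP F n K h c₀ cB a U₀ x) (DL2 F n K c₀ U₀ l)
    rw [← hxd] at htri
    exact pow_le_pow_left₀ (norm_nonneg _) htri 2
  have hQ : 0 ≤ a * ‖Qk F n K h c₀ cB U₀ x‖ ^ 2 := by positivity
  -- the window, multiplied by the (non-negative) squared norms
  have hm1 : min (γ - 3 * τ - 1029 * ε₀) (1 - 288 * ε₀ ^ 2 - 4 * τ) ≤ γ - 3 * τ - 1029 * ε₀ := min_le_left _ _
  have hm2 : min (γ - 3 * τ - 1029 * ε₀) (1 - 288 * ε₀ ^ 2 - 4 * τ) ≤ 1 - 288 * ε₀ ^ 2 - 4 * τ := min_le_right _ _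
  have hm0 : 0 ≤ min (γ - 3 * τ - 1029 * ε₀) (1 - 288 * ε₀ ^ 2 - 4 * τ) := le_min (by linarith) (by linarith)
  have hmA := mul_le_mul_of_nonneg_right hm1 (sq_nonneg ‖gaugeCorrP F n K h c₀ cB a U₀ x‖)
  have hmg := mul_le_mul_of_nonneg_right hm2 (sq_nonneg ‖DL2 F n K c₀ U₀ l‖)
  have hmx := mul_le_mul_of_nonneg_left hnx hm0
  have hAg := mul_nonneg hm0 (sq_nonneg (‖gaugeCorrP F n K h c₀ cB a U₀ x‖ - ‖DL2 F n K c₀ U₀ l‖))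
  have hθx := mul_nonneg (mul_nonneg (by norm_num : (0 : ℝ) ≤ 1029) hε₀.le) (sq_nonneg ‖x‖)
  linarith [h3x, h3A, hk4, h5, hpen, hgfA, hT1, hT2, hT3, hT4, hτsq, hQ, hmA, hmg, hmx, hAg, eT]

/-- ★ **ONE SLICE ROW FOR ALL SLOTS**: a gauge-fixed slice floor `γ` for `Δ^η + aQ_k†Q_k` and a J-term bound `‖⟨u, T v⟩‖ ≤ τ‖u‖‖v‖` give the slice floor `γ − τ` for
`Δ^η + T + aQ_k†Q_k` (every background; so the `Δ_πᴾ`, `Δ₁ᴾ(T_J)` and `Δ^η + T_J` rows of this lane all read ONE analytic row `γ` plus `τ`).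
[cite: Balaban1985BackgroundPropagators, (3.127)–(3.130) p.421, Thm 3.11 p.416] -/
theorem gaugeFixedFloor_add_of_bound
    (T : GaugeField (F.P K) 0 (Matrix.specialUnitaryGroup (Fin 2) ℂ) → (BondL2K ℂ 3 (periodsT3 F K) c₀ W₂ →ₗ[ℂ] BondL2K ℂ 3 (periodsT3 F K) c₀ W₂))
    (U₀ : GaugeField (F.P K) 0 (Matrix.specialUnitaryGroup (Fin 2) ℂ)) {γ τ : ℝ}
    (hT : ∀ u v : BondL2K ℂ 3 (periodsT3 F K) c₀ W₂, ‖⟪u, T U₀ v⟫_ℂ‖ ≤ τ * ‖u‖ * ‖v‖)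
    (hgf : ∀ A : BondL2K ℂ 3 (periodsT3 F K) c₀ W₂, RS F n K h c₀ cB U₀ (DstarL2 F n K c₀ U₀ A) = 0 →
      γ * ‖A‖ ^ 2 ≤ RCLike.re ⟪A, DeltaEta F n K c₀ U₀ A⟫_ℂ + a * ‖Qk F n K h c₀ cB U₀ A‖ ^ 2) :
    ∀ A : BondL2K ℂ 3 (periodsT3 F K) c₀ W₂, RS F n K h c₀ cB U₀ (DstarL2 F n K c₀ U₀ A) = 0 →
      (γ - τ) * ‖A‖ ^ 2 ≤ RCLike.re ⟪A, DeltaEta F n K c₀ U₀ A + T U₀ A⟫_ℂ + a * ‖Qk F n K h c₀ cB U₀ A‖ ^ 2 := by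
  intro A hA
  have h1 := hgf A hA
  have h2 : -(τ * ‖A‖ * ‖A‖) ≤ RCLike.re ⟪A, T U₀ A⟫_ℂ := by
    have h3 := RCLike.re_le_norm (K := ℂ) (-⟪A, T U₀ A⟫_ℂ)
    rw [map_neg, norm_neg] at h3
    linarith [hT A A]
  rw [inner_add_right, map_add]
  nlinarith [h1, h2]

end Lift

/-! ## §6 The family-level raw-slot coercivity row behind the `Lift` antecedent of record -/

section Family

open Literature.MathematicalPhysics.QuantumFieldTheory.Balaban1983to89.T3Thm1Carrier (Idx)

/-- ★★ **THE QUANTITATIVE COERCIVITY ROW AT THE RAW SLOT `Δ^η + T_J` IN THE EX FACE'S LETTERS, BEHIND THE LIFT ANTECEDENT OF RECORD, FROM THE GAUGE-FIXED SLICE ROW AND A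
J-TERM BOUND** (`Lift` OPAQUE + one row `hLiftRec : Lift L i U₀ → ⟨record lifting predicate⟩`, token convention of LIFT-THREAD 2; window `10¹²·L³·αcap L ≤ 1`): slice floor
`γ L i` on `{R_S D* A = 0}` and `‖⟨u, T_J(U₀)v⟩‖ ≤ τ L i‖u‖‖v‖` over `RegPr ρ U₀`, `ρ ≤ αcap L`, with the member windows `3τ + 1029·αcap L ≤ γ`, `288(αcap L)² + 4τ ≤ 1`
⟹ `(min (γ − 3τ − 1029αcap) (1 − 288αcap² − 4τ) ∕ 4 − 1029αcap)·‖x‖² ≤ re⟨x, laplaceA … (a L i) (DeltaEtaSlot + T L i) U₀ x⟩` behind `Lift L i U₀ →`.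
[cite: Balaban1985BackgroundPropagators, Thm 3.11 p.416, (3.26) p.395, (3.10) p.392; Balaban1985Variational, (141)–(142) p.299] -/
theorem coerciveRow_rawSlot_of_gaugeFixedRow_lift
    (Lift : ∀ (L : ℕ) (i : Idx L), GaugeField (i.1.1.P i.1.2.2) 0 (Matrix.specialUnitaryGroup (Fin 2) ℂ) → Prop)
    (hLiftRec : ∀ (L : ℕ) (i : Idx L) (U₀ : GaugeField (i.1.1.P i.1.2.2) 0 (Matrix.specialUnitaryGroup (Fin 2) ℂ)), Lift L i U₀ →
      ∀ cf : Site (i.1.1.P i.1.2.2) (i.1.2.2 - i.1.2.1) → Matrix (Fin 2) (Fin 2) ℂ,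
        (∀ e' : PBond (i.1.1.P i.1.2.2) (i.1.2.2 - i.1.2.1), cf e'.src = ((emlIterU (i.1.2.2 - i.1.2.1) (bgUnits i.1.1 i.1.2.2 U₀) e' : (Matrix (Fin 2) (Fin 2) ℂ)ˣ) : Matrix (Fin 2) (Fin 2) ℂ) * cf e'.tgt *
          (((emlIterU (i.1.2.2 - i.1.2.1) (bgUnits i.1.1 i.1.2.2 U₀) e')⁻¹ : (Matrix (Fin 2) (Fin 2) ℂ)ˣ) : Matrix (Fin 2) (Fin 2) ℂ)) →
        ∃ l₀ : Site (i.1.1.P i.1.2.2) 0 → Matrix (Fin 2) (Fin 2) ℂ,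
          (∀ b' : PBond (i.1.1.P i.1.2.2) 0, l₀ b'.src = ((bgUnits i.1.1 i.1.2.2 U₀ b' : (Matrix (Fin 2) (Fin 2) ℂ)ˣ) : Matrix (Fin 2) (Fin 2) ℂ) * l₀ b'.tgt * (((bgUnits i.1.1 i.1.2.2 U₀ b')⁻¹ : (Matrix (Fin 2) (Fin 2) ℂ)ˣ) : Matrix (Fin 2) (Fin 2) ℂ)) ∧
          ∀ y : Site (i.1.1.P i.1.2.2) (i.1.2.2 - i.1.2.1), l₀ (embIter (i.1.2.2 - i.1.2.1) y) = cf y)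
    (αcap : ℕ → ℝ) (hαcap : ∀ L : ℕ, 1 < L → 0 < αcap L) (hαW : ∀ L : ℕ, 1 < L → 10 ^ 12 * (L : ℝ) ^ 3 * αcap L ≤ 1)
    (c₀ cB : ℕ → ℝ) [hc₀ : ∀ L : ℕ, Fact (0 < c₀ L)] [hcB : ∀ L : ℕ, Fact (0 < cB L)]
    (a : ∀ L : ℕ, Idx L → ℝ) (ha : ∀ (L : ℕ) (i : Idx L), 0 < a L i)
    (T : ∀ (L : ℕ) (i : Idx L), GaugeField (i.1.1.P i.1.2.2) 0 (Matrix.specialUnitaryGroup (Fin 2) ℂ) →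
      (BondL2K ℂ 3 (periodsT3 i.1.1 i.1.2.2) (c₀ L) W₂ →ₗ[ℂ] BondL2K ℂ 3 (periodsT3 i.1.1 i.1.2.2) (c₀ L) W₂))
    (γ τ : ∀ L : ℕ, Idx L → ℝ) (hτ : ∀ (L : ℕ) (i : Idx L), 0 ≤ τ L i)
    (hwin₁ : ∀ (L : ℕ) (i : Idx L), 1 < L → 3 * τ L i + 1029 * αcap L ≤ γ L i)
    (hwin₂ : ∀ (L : ℕ) (i : Idx L), 1 < L → 288 * αcap L ^ 2 + 4 * τ L i ≤ 1)
    (hTJ : ∀ (L : ℕ), 1 < L → ∀ (i : Idx L) (U₀ : GaugeField (i.1.1.P i.1.2.2) 0 (Matrix.specialUnitaryGroup (Fin 2) ℂ)), ∀ ρ : ℝ,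
      RegPr i.1.1 i.1.2.1 i.1.2.2 ρ U₀ → ρ ≤ αcap L →
        ∀ u v : BondL2K ℂ 3 (periodsT3 i.1.1 i.1.2.2) (c₀ L) W₂, ‖⟪u, T L i U₀ v⟫_ℂ‖ ≤ τ L i * ‖u‖ * ‖v‖)
    (hGF : ∀ (L : ℕ), 1 < L → ∀ (i : Idx L) (U₀ : GaugeField (i.1.1.P i.1.2.2) 0 (Matrix.specialUnitaryGroup (Fin 2) ℂ)), ∀ ρ : ℝ,
      RegPr i.1.1 i.1.2.1 i.1.2.2 ρ U₀ → ρ ≤ αcap L →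
        ∀ A : BondL2K ℂ 3 (periodsT3 i.1.1 i.1.2.2) (c₀ L) W₂,
          RS i.1.1 i.1.2.1 i.1.2.2 i.2.2.le (c₀ L) (cB L) U₀ (DstarL2 i.1.1 i.1.2.1 i.1.2.2 (c₀ L) U₀ A) = 0 →
            γ L i * ‖A‖ ^ 2 ≤ RCLike.re ⟪A, DeltaEta i.1.1 i.1.2.1 i.1.2.2 (c₀ L) U₀ A + T L i U₀ A⟫_ℂ
              + a L i * ‖Qk i.1.1 i.1.2.1 i.1.2.2 i.2.2.le (c₀ L) (cB L) U₀ A‖ ^ 2) :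
    ∀ (L : ℕ), 1 < L → ∀ (i : Idx L) (U₀ : GaugeField (i.1.1.P i.1.2.2) 0 (Matrix.specialUnitaryGroup (Fin 2) ℂ)), ∀ ρ : ℝ,
      RegPr i.1.1 i.1.2.1 i.1.2.2 ρ U₀ → ρ ≤ αcap L → Lift L i U₀ →
        ∀ x : BondL2K ℂ 3 (periodsT3 i.1.1 i.1.2.2) (c₀ L) W₂,
          (min (γ L i - 3 * τ L i - 1029 * αcap L) (1 - 288 * αcap L ^ 2 - 4 * τ L i) / 4 - 1029 * αcap L) * ‖x‖ ^ 2
            ≤ RCLike.re ⟪x, laplaceA i.1.1 i.1.2.1 i.1.2.2 i.2.2.le (c₀ L) (cB L) (a L i)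
              (DeltaEtaSlot i.1.1 i.1.2.1 i.1.2.2 (c₀ L) + T L i) U₀ x⟫_ℂ := by
  intro L hL i U₀ ρ hreg hρ hlift
  have hreg' : RegPr i.1.1 i.1.2.1 i.1.2.2 (αcap L) U₀ := T3PrintedMinimiserExistence.regPr_mono i.1.1 hρ hreg
  have hW : 10 ^ 12 * (i.1.1.L : ℝ) ^ 3 * αcap L ≤ 1 := by rw [i.2.1]; exact hαW L hL
  exact coercive_laplaceA_rawSlot_of_gaugeFixed_of_lift i.1.1 i.2.2.le (hαcap L hL) hW (ha L i).le (T L i) U₀ hreg' (hLiftRec L i U₀ hlift)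
    (hτ L i) (fun u v => hTJ L hL i U₀ (αcap L) hreg' le_rfl u v) (hwin₁ L i hL) (hwin₂ L i hL)
    (fun A hA => hGF L hL i U₀ (αcap L) hreg' le_rfl A hA)

open Summit.QuantumFields.YangMills.Theorems.Prop7SectET3DeltaOnePInv (TJSlotP)

/-- ★★ **THE EX DISPLAY ROW `hPosΔ` BEHIND THE LIFT ANTECEDENT (its LIFT-THREAD 2 text: `Lift L i U₀ →` inserted after `ρ ≤ αcap L →`) FROM THE GAUGE-FIXED SLICE ROW AND A
J-TERM BOUND**: with `T := TJSlotP` (the J-term of record) and the STRICT window `4·1029·αcap L < min (γ − 3τ − 1029αcap) (1 − 288αcap² − 4τ)`, the raw-slot coercivity row has a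
positive constant, hence `0 < re⟨x, Δ_a x⟩` for `x ≠ 0` — the displayed binder's conclusion at slot `DeltaEtaSlot + TJSlotP`.
[cite: Balaban1985BackgroundPropagators, Thm 3.11 p.416, (3.26) p.395, (3.127)–(3.128) p.421; Balaban1985Variational, (141)–(142) p.299] -/
theorem hPosΔ_lift_of_gaugeFixedRow
    (Lift : ∀ (L : ℕ) (i : Idx L), GaugeField (i.1.1.P i.1.2.2) 0 (Matrix.specialUnitaryGroup (Fin 2) ℂ) → Prop)
    (hLiftRec : ∀ (L : ℕ) (i : Idx L) (U₀ : GaugeField (i.1.1.P i.1.2.2) 0 (Matrix.specialUnitaryGroup (Fin 2) ℂ)), Lift L i U₀ →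
      ∀ cf : Site (i.1.1.P i.1.2.2) (i.1.2.2 - i.1.2.1) → Matrix (Fin 2) (Fin 2) ℂ,
        (∀ e' : PBond (i.1.1.P i.1.2.2) (i.1.2.2 - i.1.2.1), cf e'.src = ((emlIterU (i.1.2.2 - i.1.2.1) (bgUnits i.1.1 i.1.2.2 U₀) e' : (Matrix (Fin 2) (Fin 2) ℂ)ˣ) : Matrix (Fin 2) (Fin 2) ℂ) * cf e'.tgt *
          (((emlIterU (i.1.2.2 - i.1.2.1) (bgUnits i.1.1 i.1.2.2 U₀) e')⁻¹ : (Matrix (Fin 2) (Fin 2) ℂ)ˣ) : Matrix (Fin 2) (Fin 2) ℂ)) →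
        ∃ l₀ : Site (i.1.1.P i.1.2.2) 0 → Matrix (Fin 2) (Fin 2) ℂ,
          (∀ b' : PBond (i.1.1.P i.1.2.2) 0, l₀ b'.src = ((bgUnits i.1.1 i.1.2.2 U₀ b' : (Matrix (Fin 2) (Fin 2) ℂ)ˣ) : Matrix (Fin 2) (Fin 2) ℂ) * l₀ b'.tgt * (((bgUnits i.1.1 i.1.2.2 U₀ b')⁻¹ : (Matrix (Fin 2) (Fin 2) ℂ)ˣ) : Matrix (Fin 2) (Fin 2) ℂ)) ∧
          ∀ y : Site (i.1.1.P i.1.2.2) (i.1.2.2 - i.1.2.1), l₀ (embIter (i.1.2.2 - i.1.2.1) y) = cf y)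
    (αcap : ℕ → ℝ) (hαcap : ∀ L : ℕ, 1 < L → 0 < αcap L) (hαW : ∀ L : ℕ, 1 < L → 10 ^ 12 * (L : ℝ) ^ 3 * αcap L ≤ 1)
    (c₀ cB : ℕ → ℝ) [hc₀ : ∀ L : ℕ, Fact (0 < c₀ L)] [hcB : ∀ L : ℕ, Fact (0 < cB L)]
    (a : ∀ L : ℕ, Idx L → ℝ) (ha : ∀ (L : ℕ) (i : Idx L), 0 < a L i)
    (γ τ : ∀ L : ℕ, Idx L → ℝ) (hτ : ∀ (L : ℕ) (i : Idx L), 0 ≤ τ L i)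
    (hwin₁ : ∀ (L : ℕ) (i : Idx L), 1 < L → 3 * τ L i + 1029 * αcap L ≤ γ L i)
    (hwin₂ : ∀ (L : ℕ) (i : Idx L), 1 < L → 288 * αcap L ^ 2 + 4 * τ L i ≤ 1)
    (hwin₃ : ∀ (L : ℕ) (i : Idx L), 1 < L → 4 * (1029 * αcap L) < min (γ L i - 3 * τ L i - 1029 * αcap L) (1 - 288 * αcap L ^ 2 - 4 * τ L i))
    (hTJ : ∀ (L : ℕ), 1 < L → ∀ (i : Idx L) (U₀ : GaugeField (i.1.1.P i.1.2.2) 0 (Matrix.specialUnitaryGroup (Fin 2) ℂ)), ∀ ρ : ℝ,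
      RegPr i.1.1 i.1.2.1 i.1.2.2 ρ U₀ → ρ ≤ αcap L →
        ∀ u v : BondL2K ℂ 3 (periodsT3 i.1.1 i.1.2.2) (c₀ L) W₂,
          ‖⟪u, TJSlotP i.1.1 i.1.2.1 i.1.2.2 i.2.2.le (c₀ L) (cB L) (a L i) U₀ v⟫_ℂ‖ ≤ τ L i * ‖u‖ * ‖v‖)
    (hGF : ∀ (L : ℕ), 1 < L → ∀ (i : Idx L) (U₀ : GaugeField (i.1.1.P i.1.2.2) 0 (Matrix.specialUnitaryGroup (Fin 2) ℂ)), ∀ ρ : ℝ,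
      RegPr i.1.1 i.1.2.1 i.1.2.2 ρ U₀ → ρ ≤ αcap L →
        ∀ A : BondL2K ℂ 3 (periodsT3 i.1.1 i.1.2.2) (c₀ L) W₂,
          RS i.1.1 i.1.2.1 i.1.2.2 i.2.2.le (c₀ L) (cB L) U₀ (DstarL2 i.1.1 i.1.2.1 i.1.2.2 (c₀ L) U₀ A) = 0 →
            γ L i * ‖A‖ ^ 2 ≤ RCLike.re ⟪A, DeltaEta i.1.1 i.1.2.1 i.1.2.2 (c₀ L) U₀ A + TJSlotP i.1.1 i.1.2.1 i.1.2.2 i.2.2.le (c₀ L) (cB L) (a L i) U₀ A⟫_ℂ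
              + a L i * ‖Qk i.1.1 i.1.2.1 i.1.2.2 i.2.2.le (c₀ L) (cB L) U₀ A‖ ^ 2) :
    ∀ (L : ℕ), 1 < L → ∀ (i : Idx L) (U₀ : GaugeField (i.1.1.P i.1.2.2) 0 (Matrix.specialUnitaryGroup (Fin 2) ℂ)), ∀ ρ : ℝ, RegPr i.1.1 i.1.2.1 i.1.2.2 ρ U₀ → ρ ≤ αcap L →
      Lift L i U₀ →
      ∀ x : BondL2K ℂ 3 (periodsT3 i.1.1 i.1.2.2) (c₀ L) W₂, x ≠ 0 →
        0 < RCLike.re ⟪x, laplaceA i.1.1 i.1.2.1 i.1.2.2 i.2.2.le (c₀ L) (cB L) (a L i) ((DeltaEtaSlot i.1.1 i.1.2.1 i.1.2.2 (c₀ L) + TJSlotP i.1.1 i.1.2.1 i.1.2.2 i.2.2.le (c₀ L) (cB L) (a L i))) U₀ x⟫_ℂ := by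
  intro L hL i U₀ ρ hreg hρ hlift x hx
  have hrow := coerciveRow_rawSlot_of_gaugeFixedRow_lift Lift hLiftRec αcap hαcap hαW c₀ cB a ha
    (fun L i => TJSlotP i.1.1 i.1.2.1 i.1.2.2 i.2.2.le (c₀ L) (cB L) (a L i)) γ τ hτ hwin₁ hwin₂ hTJ hGF L hL i U₀ ρ hreg hρ hlift x
  have hc : 0 < min (γ L i - 3 * τ L i - 1029 * αcap L) (1 - 288 * αcap L ^ 2 - 4 * τ L i) / 4 - 1029 * αcap L := by
    have := hwin₃ L i hL; linarith
  have hxx : 0 < ‖x‖ ^ 2 := pow_pos (norm_pos_iff.2 hx) 2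
  exact lt_of_lt_of_le (mul_pos hc hxx) hrow

end Family

end Summit.QuantumFields.YangMills.Theorems.Prop7CoerciveRawSlotOfGaugeFixedLift

end
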